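import Mathlib
import HarnessLib
import HarnessLib.Audit
import Summits.AtomisticToContinuum.Statement
import Literature.MathematicalPhysics.QuantumManyBody.PeriodicBoseGas
import Summits.AtomisticToContinuum.BoseEinsteinCondensation.Theorems.BECSectorPoincareTwoScaleScatteringLengthFinite
import HarnessLib.Audit.Status.Attr

/-!
Route: BECInfDivCoherence

# Route BECInfDivCoherence — coherence is infinitely divisible — torus BEC as a finite Lévy mass of
log γ (negative type of −log γ on an infrared grid + a negative-moment infrared bound), false in d=1
by (π−4)²>0

It suffices to show X = GridInfDivCoherence ∧ LevyNegativeMoment (card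
levy-coherence-strings-vs-clouds, items K1 = (ID) in its
infrared form and the negative-moment bound of its M4), together with the shared boundary-condition
transfer BoundaryTransferWeak of
route BECPeriodicReduction (stmt-0827). Setting: δ-near-minimisers Ψ of the PERIODIC N-body energy
on the torus of side L = (N/ρ)^(1/3),
their translation coherence G_Ψ(r) = Re ∫ conj Ψ(…, x_i + r, …) Ψ dX (= γ̄(r)/ρ, G(0) = 1), sampled
on the grid (L/m)ℤ³, m = ⌊L/η⌋,
and the DISCRETE LÉVY WEIGHTS ν̃_q = m⁻³ Σ_j log G(r_j) cos(2π q·j/m), q ∈ (ℤ/m)³ ∖ 0.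
GridInfDivCoherence (INFRARED INFINITE DIVISIBILITY): for every repulsive finite-range v there is a
UV scale η > 0 and ρ₀ > 0 such that
for 0 < ρ < ρ₀, all large N, every ε > 0, some δ > 0: every δ-near-minimiser has G_Ψ > 0 and ν̃_q ≥
−ε for all q ≢ 0 — i.e. on the
η-grid −log G_Ψ is conditionally negative definite (Schoenberg), G_Ψ restricted to the grid is an
infinitely divisible kernel.
LevyNegativeMoment (LOG-LEVEL INFRARED BOUND): for every η > 0 there are C and ρ₀ > 0 with Σ_(q≠0)
max(ν̃_q, 0)/|k_q| ≤ C
(|k_q| = (2π/L)‖q̄‖) for near-minimisers, uniformly in N — the Lévy measure of the coherence has a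
bounded (−1)-moment.
Lean: `GridInfDivCoherence ∧ LevyNegativeMoment ∧ BoundaryTransferWeak`

## Assembly
Pure logic. The DECIDING THEOREM (glue.lean, D-0027 §2.1; hypotheses = the route's seven items, cone
repair 2026-08-15) is `theorem closes :
GridInfDivCoherence → LevyNegativeMoment → BoundaryTransferWeak → ScatteringLengthFinite →
GridAverageCondensate → LevyMassCondensation →
Assembly → _root_.BoseEinsteinCondensation := fun h1 h2 h6 h3 h4 h5 _ v hv => h6 v hv (h5 h1 h2 h3
h4 v hv)` (rc 0 in Sketch.lean, axioms
propext/Classical.choice/Quot.sound; conclusion = the audited sub-problem Statement decl, by name):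
the glue
LevyMassCondensation turns the two cruxes (with the two provable-now supports) into PeriodicBEC —
constant-mode condensation for
near-minimisers on the torus, the signature of BECPeriodicReduction.PeriodicBEC — and
BoundaryTransferWeak carries it to the Dirichlet,
mode-free conjunct. The d = 1 delimiter (two impenetrable bosons on a ring violate negative type of
−log γ: γ₂(0)·γ₂(L/2) < γ₂(L/4)², i.e.
(π−4)² > 0; card T1/P2, re-derived by two refuter passes) is recorded under NUMBERS and is
deliberately NOT an item after the cone repair of
2026-08-15: typing it on girardeauDensityMatrix imported
Literature.Barriers.AtomisticToContinuum.OneDimensionalHardCore, whose unproved printed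
law OneDimensionalHardCoreSqrt put the whole route in blocked-by-cone; it was never used in the
assembly and may be proved at any time as a
Barriers-side theorem.

Rationale: WHY THIS LINE. (Successor of route BECLevyCoherence, retired 2026-08-15T13:39Z `not-a-thesis` only
because its Assembly named the Literature constant instead
of the sub-problem Statement decl; same items, now with the D-0027 §2.1 deciding theorem `closes … →
_root_.BoseEinsteinCondensation`.)
Mechanism (card levy-coherence-strings-vs-clouds): if −log G is of negative type then, by
Lévy–Khintchine on the finite torus grid,
−log G(r) = Σ_q ν̃_q (1 − cos k_q·r) with ν̃ ≥ 0, the grid geometric mean of G is exp(−Σ ν̃_q), and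
the condensate fraction is a
zero-phonon (Debye–Waller) weight f₀ ≳ e^(−|ν̃|): BEC ⟺ finite Lévy mass. The Lévy mass is then
bounded by TWO MOMENTS of a positive
measure — the second moment is the kinetic energy per particle (discrete f-sum Σ ν̃_q λ_q = Δ_h(−log
G)(0) ≤ 2τ, τ ≤ E₀/N ≤ 4πρa(1+Ca/b)
by the PROVED fact LSSY2005_upperBound_periodic_holds) and the (−1)-moment is the crux
LevyNegativeMoment — via Hölder
|ν̃| ≤ (Σν̃|k|²)^(1/3)(Σν̃/|k|)^(2/3); every estimate is multiplicative, so no smallness of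
constants is ever needed (an occupation-level
argument must certify Σ_(k≠0) n_k ≤ (1−c)N). Imported area: harmonic analysis on semigroups /
infinitely divisible kernels (Schoenberg1938;
BergChristensenRessel1984 Ch. 3 Thm 2.2, Prop 2.7; BergForst1975) pointed at the one-body density
matrix, whose Gaussian (Bogoliubov) level
is exactly of this form (MoraCastin2003 §4.3: ln g₁/ρ = g₁^Bog/ρ − 1 to order ε²;
GavoretNozieres1964, Griffin1993 §4.1 for n_k ~ n₀mc/2|k|).
What is new relative to the 35 open routes of this conjunct (none uses negative type, Hadamard
powers or log γ; negatives index empty): the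
SIGN of the transform of log γ as the structural hypothesis, a d = 1 counterexample computed on the
Girardeau pair density matrix (card T1/P2; an item until the cone repair of 2026-08-15 — details in
the paragraph on
deferred decompositions below), and a grid (UV-safe, finite-Fourier) formulation matching the card's
38-instance exact-diagonalisation census.

RANKED CRUXES. #2 GridInfDivCoherence (crux) — (card K1, infrared form) for every repulsive
finite-range v there are η > 0 and ρ₀ > 0 such that for 0 < ρ < ρ₀, for all large N, for every ε > 0
there is δ > 0 with: every δ-near-minimiser Ψ of the periodic energy on the torus of side L =
(N/ρ)^(1/3) has strictly positive translation coherence G_Ψ(i,·) and, on the grid of m = ⌊L/η⌋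
points per side, all discrete Lévy weights ν̃_q = m⁻³ Σ_j log G_Ψ(i, (L/m)j) cos(2π q·j/m), q ≢ 0
mod m, are ≥ −ε (−log G_Ψ is conditionally negative definite on the grid; rank 2: line-defining and
cheaply falsifiable). [difficulty: open-problem] (why it might fail: The sign is not automatic: UV
zeros of the pair amplitude give negative continuum weights at |k|~π/a (N=2: mass fraction 1e-6 at
L/R=10) which grid sampling folds onto infrared classes; an infrared failure needs string-like order
(d=1: one negative weight at 2k_F) — unproven absent in a 3D fluid.) [MoraCastin2003,
Schoenberg1938, BergChristensenRessel1984, PenroseOnsager1956, ForresterEtAl2003]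
#3 LevyNegativeMoment (crux) — (card M4, the quantity LOGCLUSTER was designed to bound) for every
repulsive finite-range v and every grid scale η > 0 there are C and ρ₀ > 0 such that for 0 < ρ < ρ₀,
for all large N, some δ > 0: every δ-near-minimiser satisfies Σ_(q≢0) max(ν̃_q,0)/|k_q| ≤ C with
|k_q| = (2π/L)·(centred norm of q) — the positive part of the grid Lévy measure has an N-uniform
(−1)-moment (Bogoliubov value ≈ √2·a/π, density-independent; C may depend on v and η but not on ρ,
N). [difficulty: open-problem] (why it might fail: A log-level infrared bound (Lévy weights summable
against 1/|k| uniformly in N and in ρ→0): any expansion proof meets BogoliubovPerturbationInfrared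
at d=3, and beyond one-jump dominance ν_k≈n_k/n₀ nothing non-perturbative controls ν; ρ-uniformity
of C is an extra bet.) [GavoretNozieres1964, Griffin1993, MoraCastin2003,
LiebSeiringerSolovejYngvason2005, Fournais2020]
#4 BoundaryTransferWeak (crux) — (shared with BECPeriodicReduction, stmt-0827, verbatim) for each
repulsive finite-range v, constant-mode condensation for near-minimisers of the periodic problem at
all small densities implies the conjunct's Dirichlet, mode-free criterion HasGroundStateBEC v ρ for
all small ρ. [difficulty: L] (why it might fail: PeriodicBEC(v) is ground-state-only (δ after N):
the Dirichlet ground state lies a wall term ≫ δ above E₀^per and interior restrictions are neither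
periodic nor of sharp N, so the hypothesis may never fire; BEC is boundary-condition sensitive
(Robinson1976).) [LiebSeiringerSolovejYngvason2005, BoccatoSeiringer2023, Junge2026, Robinson1976,
LauwersVerbeureZagrebnov2003]
#9 GridAverageCondensate (support) — (aliasing / Poincaré on cells, provable now) for L > 0, m ≥ 1,
T ≥ 0, any periodic trial state Ψ with total kinetic energy ≤ T and any particle i:
condensateOccupation N L Ψ ≥ N·(grid average of G_Ψ(i,·) over the m³ nodes (L/m)j) − T(L/m)²/(4π²).
Proof: grid average = Σ_(k∈(2πm/L)ℤ³) g_k with g_k = n_k/N ≥ 0 (Fourier in particle i), g_0 = n₀/N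
by the definition of condensateOccupation, and Σ_(|k|≥2πm/L) g_k ≤ (L/2πm)² Σ |k|² g_k =
(L/2πm)²·(∫|∇_iΨ|²) = (L/2πm)² T/N by Bose symmetry. [difficulty: provable-now] [Fournais2020,
LiebSeiringerSolovejYngvason2005]
#9 ScatteringLengthFinite (support) — (shared with BECPinning / EqualScatteringTransfer, stmt-0851)
finite range R₀ ⇒ scatteringLength v ≠ ⊤ (trial φ ∈ C¹, φ = 0 on B_R₀, φ = 1 off B_(R₀+1), so v·φ² =
0 including hard cores since ⊤·0 = 0; scatteringLength_le). Needed by the glue to invoke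
LSSY2005_upperBound_periodic_holds. [difficulty: provable-now] [LiebSeiringerSolovejYngvason2005]
#9 LevyMassCondensation (support) — (glue, card M3–M4; conclusion = BECPeriodicReduction.PeriodicBEC
= stmt-0826 body verbatim, so closing it closes 0826 by a one-line theorem) GridInfDivCoherence →
LevyNegativeMoment → ScatteringLengthFinite → GridAverageCondensate → constant-mode BEC for
near-minimisers on the torus at all small densities. Proof (finite-dimensional but for two inputs):
fix v, take η, ρ₀ from GridInfDiv and C from LevyNegativeMoment at that η; for N large h := L/m ∈
[η, 2η), τ := (E₀^per+δ)/N ≤ τ* := 8πρa + 1 (LSSY2005_upperBound_periodic_holds +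
ScatteringLengthFinite); (i) G > 0 on the grid, F := log G∘nodes is real, even on (ℤ/m)³, so F(j) =
Σ_q ν̃_q cos(2πq·j/m) and −F(j) = Σ_(q≠0) ν̃_q(1 − cos) (F(0)=0); (ii) discrete f-sum: Σ_q ν̃_q λ_q
= −(2/h²)Σ_a F(e_a) ≤ 2τ since 1 − G(he_a) ≤ τ_a h²/2 (‖T_rΨ−Ψ‖ ≤ |r|‖∂_rΨ‖) and −log x ≤ 2(1−x) on
[1/2,1], where λ_q = (2/h²)Σ_a(1−cos(2πq̄_a/m)) ≥ (4/π²)|k_q|²; with ν̃ ≥ −ε and ε := h²/(12m³): Σ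
ν̃⁺|k_q|² ≤ (π²/4)(2τ*+1); (iii) Hölder(3,3/2): Λ := Σ_(q≠0) ν̃_q ≤ Σ ν̃⁺ ≤ ((π²/4)(2τ*+1))^(1/3)
C^(2/3) =: Λ*; (iv) AM–GM over the m³ grid values: grid average of G ≥ exp(mean F) = e^(−Λ) ≥
e^(−Λ*); (v) GridAverageCondensate: n₀/N ≥ e^(−Λ*) − τ*(2η)²/(4π²) ≥ e^(−Λ*)/2 =: c once ρ is small
(τ* → 1 is harmless: choose ε smaller, or note τ*η² ≤ (8πρa+δ/N)·η² with δ ≤ 1). [difficulty: M]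
[BergChristensenRessel1984, LiebSeiringerSolovejYngvason2005, Fournais2020]

TWO-LAYER PLAN. Foreseen glued splits (k ≤ 3, depth 1), none filed now: LevyNegativeMoment ⇐
LogCluster (card K2: |log G(r) − ⟨log G⟩| ≤ A(r/ξ)^(−1−ε′)
for r ≥ Mξ, uniformly in L) → ShortRangeLevyMass (the r < Mξ part, ≤ (2/π)Mξ|ν̃| which the bootstrap
absorbs) → LevyNegativeMoment
(card M4: M_(−1) = V⁻¹∫ C_ν K_1, K_1 ≈ 1/2π²r²). GridInfDivCoherence ⇐ PerturbativeWindow (ν̃ ≥ 0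
wherever the renormalised Bogoliubov
expansion is summable, MoraCastin2003 order ε²) → InfraredExtension (one-jump dominance ν_k ≃ n_k/n₀
as k → 0) → GridInfDivCoherence.
BoundaryTransferWeak: as planned in BECPeriodicReduction (Neumann bracketing + mode-free criterion
λ_max ≥ tr γ²/N).

KILL CRITERIA. One negative infrared discrete Lévy weight (ν̃_q < 0, |k_q| ≲ 1/ξ, robust as L grows)
in ANY d ≥ 2 many-body repulsive Bose ground state —
lattice ED/DMRG on 6×6, 8×8 tori to half filling or worm/PIGS QMC for 3D hard or soft spheres at ρa³
= 10⁻⁴…10⁻², N = 64…512 — refutes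
GridInfDivCoherence and closes the route `refuted:GridInfDivCoherence` (the d = 1 witness and the
census then stand as negative knowledge on
harmonic-fluid exactness). A proof that Σν̃⁺/|k| grows with N for some admissible v refutes
LevyNegativeMoment only: pivot to the LogCluster
split or to p-moments Σν̃⁺/|k|^p, 0 < p < 2 (Hölder works for any p < 2). PeriodicBEC (stmt-0826)
proved by any other route moots both cruxes;
¬BoundaryTransferWeak breaks every torus route at once.

NOT DECOMPOSED YET. The discrete Lévy–Khintchine / Hölder / AM–GM bookkeeping inside
LevyMassCondensation (prover helper lemmas, `--supports`); the constants
(π²/4, factor 2 in the f-sum, ε := h²/12m³); positivity G_Ψ > 0 for near-minimisers (folded into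
GridInfDivCoherence, where it belongs:
infinite divisibility is a property of positive kernels); the GP-scale corollary of
GridInfDivCoherence ALONE (card M5: |ν̃| ≤ τL²/8, hence
n₀/N ≥ e^(−τL²/8) − τh²/4π², i.e. BEC with constant e^(−g/π)-type on boxes ρaL² = g from the energy
upper bound alone) — not expressible along
L = (N/ρ)^(1/3) and left as a prover's remark; the compound-Poisson / n₀-free Gavoret–Nozières
dictionary (card M3), which motivates but is
not load-bearing; any regime split soft vs hard-core v; the d = 1 delimiter `∀ L > 0,
γ₂(0,0)·γ₂(L/2,0) < γ₂(L/4,0)²` for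
girardeauDensityMatrix 2 L (ex-item TonksPairNotInfDiv, stmt-AtomisticToContinuum-9118: closed form
γ₂(x,0) = (2/L)[(1−2r)cos πr + (2/π) sin πr],
r = |x|/L, so the claim is 16π < (π+4)², i.e. (π−4)² > 0; 2.5465 < 2.5838 at L = 1) — DROPPED in the
cone repair of 2026-08-15 because its only
purpose-built import, Literature.Barriers.AtomisticToContinuum.OneDimensionalHardCore, declares the
unproved printed law OneDimensionalHardCoreSqrt
(Szegő–Lenard √N law, no `_holds` in the tree) and thereby blocked staffing of the whole route;
provable now as a theorem next to
girardeauDensityMatrix (two one-dimensional integrals + nlinarith [Real.pi_gt_three,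
Real.pi_lt_four]), never load-bearing here.

CHEAPEST FALSIFIER. Exact diagonalisation the refuter can rerun (triage-16 has ed_pure.py):
hard-core bosons on 6×6 and 8×8 tori at fillings 0.1–0.3 (the card's
advice: aim at |k| ~ 1/ξ, moderate filling, large tori, not (π,π) at half filling) — one robust
negative nonzero-k weight of log γ kills
GridInfDivCoherence. Run so far (card + triage-16, independently): 38 + 30 instances in d = 2, 3 and
ladders, 0 negative weights, Hadamard
powers to t = 0.02 PSD, f₀/e^(−|ν|) ∈ [1.000, 1.021]; d = 1 hard-core rings: exactly one negative
weight at q = N. Second cheapest: N = 2 hard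
spheres on a 3D torus (two-body problem, exact): fold the continuum weights onto grids m = 4…16 and
check the sign of the folded sums
(tests the UV-aliasing failure mode of the grid form directly). I could not run either here (hub is
compute-free; no numpy); the toy check
I did run (Bogoliubov occupations on 24³ tori, grids m = 6…12, pure python) gives all ν̃ > 0, e^(−Λ)
= f₀ to 4 digits, the discrete f-sum
identity exact, Hölder slack 20–40 %, M_(−1) ≈ 0.21–0.39 ≈ O(a) flat in ρ.

NUMBERS. Bogoliubov values the cruxes are measured against (ħ = 2m = 1, ξ = (8πρa)^(−1/2), τξ² =
1/2): ν_k ≈ n_k/N ≈ 1/(2√2 N|k|ξ) for |k|ξ ≪ 1;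
|ν| ≈ depletion ≈ 1.5(ρa³)^(1/2)-order; M_(−1) = Σν_k/|k| → c₀a/π² (density-independent; toy
0.21–0.39 for a = 1); f-sum Σν_k|k|² = τ ≤
4πρ₁a(1 + 12a/b) (LSSY2005_upperBound_periodic_holds, C = 12). d = 1 witness:
γ₂(L/4)²/(γ₂(0)γ₂(L/2)) = (π+4)²/16π = 1.01466; ν₂ =
−1.8634·10⁻³ (N = 2), ν₃ = −1.49·10⁻³ (N = 3), L·ν_(2k_F) → −0.0122 at lattice filling 1/4. Census
minima in d ≥ 2: ν_min = 6.6·10⁻⁴…1.5·10⁻²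
(4×4), 4.1·10⁻⁵…1.3·10⁻⁴ (4×4×4). Items at open: 8 (3 cruxes, 4 support, 1 assembly); after the cone
repair of 2026-08-15: 7 (3 cruxes, 3 support,
1 assembly), extra imports = Literature.MathematicalPhysics.QuantumManyBody.PeriodicBoseGas only
(every named fact of that module and of the Statement cone
has a `_holds` theorem in the tree).

DEFINITION REQUESTS. None needed to type the items (everything is inlined over
Literature.MathematicalPhysics.QuantumManyBody.BoseGas.{PeriodicTrialState,
periodicEnergy, periodicGroundStateEnergy, sideLength, cellN, latticeVec, kineticDensity,
condensateOccupation, scatteringLength,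
IsRepulsiveFiniteRange, HasGroundStateBEC, BoseEinsteinCondensation}, all `lean search`-verified;
Sketch.lean rc 0; no Barriers import
since the cone repair). Nice-to-have later (not filed): `torusCoherence N L Ψ i r` and
`gridLevyWeight` abbreviations
under Summits/AtomisticToContinuum/BoseEinsteinCondensation/Theorems to shorten the signatures.

Novelty: Searches (2026-08-15): `lit galaxy search --star all` ×5 — "infinitely divisible kernel" (12 rows:
ML/RKHS, Donoghue, and BCR GTM 100 =
panama:508704516472908), "Hadamard power density matrix" (0), "compound Poisson momentum
distribution" (0), "negative definite kernel Bose" (0),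
"Levy-Khintchine Bose gas" (0); `lit search --hybrid --source local` "negative definite functions
Lévy-Khintchine compact abelian group
Schoenberg" (8 books: book:berg1984-harmonic-analysis-semigroups pp. 74–86, Heyer 1984, Applebaum
2014 — pure harmonic analysis, no Bose gas);
`lit frontier AtomisticToContinuum --since 2021` (30 rows; condensation entries arXiv:2510.20493,
arXiv:2603.20776 are occupation-level
localisation, nothing on log γ); `lit bridges AtomisticToContinuum --cross any` (no relevant
bridge); remote `lit search` (searchd) was
unavailable twice (rc 75) — the card's refuter audit of today (triage-16: S2/OpenAlex/arXiv/zbMATH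
×6/Crossref, 115 cards grepped) found
nothing on infinite divisibility / negative type of γ or n_k either; grep of all 35 Theses of the
conjunct for levy|negative type|infinitely
divisib|Schoenberg|Hadamard: 0.
Nearest prior art found: MoraCastin2003 (arXiv:cond-mat/0212523 §4.3: ln[g₁/ρ] = g₁^Bog/ρ − 1, the
Lévy–Khintchine form exact to order ε²);
harmonic-fluid g₁ = ρe^(−Var/2) (Haldane 1981, Popov); Schoenberg1938 and BergChristensenRessel1984
Ch. 3 Thm 2.2 / Prop 2.7 (negative type ⟺
infinitely divisible kernel); in-programme: the occupation-level torus route  [refs: 2510.20493, 2603.20776, cond-mat/0212523, book:berg1984-harmonic-analysis-semigroups, MoraCastin2003, Schoenberg1938, BergChristensenRessel1984]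

Barriers (technique_class: Schoenberg-negative-type, Levy-Khintchine, log-coherence): - technique_class: Schoenberg-negative-type, Levy-Khintchine, log-coherence
- Literature.Barriers.AtomisticToContinuum.OneDimensionalHardCore: evaded head-on — the structural
hypothesis is FALSE for the impenetrable 1D gas (d = 1 witness, card T1/P2, re-derived by two
refuter passes, recorded in the rationale and no longer an item: one negative weight at 2k_F; (π−4)²
> 0 for N = 2), so no step of the line applies verbatim in d = 1; all positive claims are d = 3
statements about near-minimisers.
- Literature.Barriers.AtomisticToContinuum.PitaevskiiStringariOneDimension: same evasion; moreover
given (ID) BEC ⟺ finite Lévy mass, and with ν ≍ 1/|k| the mass ∫d^dk ν is finite iff d ≥ 2 at T = 0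
— the barrier is "infinite Lévy activity", which LevyNegativeMoment excludes only in d = 3.
- Literature.Barriers.AtomisticToContinuum.HohenbergLowDimension: T = 0 only; the thermal law ν ≍
T/|k|² would need d ≥ 3 and is not claimed.
- Literature.Barriers.AtomisticToContinuum.BogoliubovPerturbationInfrared: it does not, for
LevyNegativeMoment, if that crux is attacked by expansion (d = 3 marginal); the bet is that a
SIGN-protected, cumulant-level quantity (Lévy masses add under approximate independence where
occupations convolve) admits a non-perturbative monotonicity/response proof; GridInfDivCoherence is
exact where the series is finite (order ε²) and is tested non-perturbatively by the census.
- Literature.Barriers.AtomisticToContinuum.KineticGapLengthScales: the f-sum enters only as the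

Novelty grade: new-combination — ROUTE REVIEW gen 3 (refuter rreview-0815T13-13-g3-0, 2026-08-15) — KEEP OPEN; third concurring pass (gen1 13-11-0, gen2 13-13-g2-0). 8/8 decls rc0 in the built module (W_BEC.lean), Assembly provable now. Conforming re-open of BECLevyCoherence (CLOSED not-a-thesis, form only) — not a recombination of (refuter refuter-rreview-0815T13-13-g3-0, 2026-08-15T15:20:45Z; prior: MoraCastin2003 (cond-mat/0212523 §4.3), BergChristensenRessel1984 Ch.3 Thm 2.2/Prop 2.7, Schoenberg1938, LiebSeiringerSolovejYngvason2005 Thm 2.2, Fournais2020 (arXiv:2011.00309), ForresterEtAl2003 (cond-mat/0211126))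

History (route lifecycle, newest last):
- 2026-08-15T16:30:09Z · rev 3: dropped TonksPairNotInfDiv — cone repair (route-repair g2, 2026-08-15): drop TonksPairNotInfDiv (stmt-AtomisticToContinuum-9118, support, the d=1 delimiter; not load-bearing — unused by clo (planner-rrepair-AtomisticToContinuum-BECInfDiv-6e28679e-g2-0)

sub-problem: BoseEinsteinCondensation · status: open · opened planner-plancard-AtomisticToContinuum-BoseEin-49a0a276-0 2026-08-15T13:48:45Z · rev 4 · ledger route-AtomisticToContinuum-BECInfDivCoherence
GENERATED by the gate from the ledger (D-0016/17). Provers cite these decls: `theorem foo : Summit.AtomisticToContinuum.BoseEinsteinCondensation.Theses.BECInfDivCoherence.<Decl> := …` in Summits/AtomisticToContinuum/BoseEinsteinCondensation/Theorems/<Name>.lean.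
-/

namespace Summit.AtomisticToContinuum.BoseEinsteinCondensation.Theses.BECInfDivCoherence

open scoped BigOperators Topology Manifold Classical MeasureTheory ProbabilityTheory Matrix InnerProductSpace ComplexConjugate ContinuousMap
open Filter Set Function TopologicalSpace MeasureTheory

attribute [summit_statement] _root_.BoseEinsteinCondensation

/-- item stmt-AtomisticToContinuum-9114 · crux · rank 2 · open · by planner
why it might fail: The sign is not automatic: UV zeros of the pair amplitude give negative continuum weights at |k|~π/a (N=2: mass fraction 1e-6 at L/R=10) which grid sampling folds onto infrared classes; an infrared failure needs string-like order (d=1: one negative weight at 2k_F) — unproven absent in a 3D fluid.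
sources: MoraCastin2003, Schoenberg1938, BergChristensenRessel1984, PenroseOnsager1956, ForresterEtAl2003
[crux] (card K1, infrared form) for every repulsive finite-range v there are η > 0 and ρ₀ > 0 such
that for 0 < ρ < ρ₀, for all large N, for every ε > 0 there is δ > 0 with: every δ-near-minimiser Ψ
of the periodic energy on the torus of side L = (N/ρ)^(1/3) has strictly positive translation
coherence G_Ψ(i,·) and, on the grid of m = ⌊L/η⌋ points per side, all discrete Lévy weights ν̃_q =
m⁻³ Σ_j log G_Ψ(i, (L/m)j) cos(2π q·j/m), q ≢ 0 mod m, are ≥ −ε (−log G_Ψ is conditionally negative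
definite on the grid; rank 2: line-defining and cheaply falsifiable). [difficulty: open-problem] -/
@[route_item "route-AtomisticToContinuum-BECInfDivCoherence", crux]
def GridInfDivCoherence : Prop :=
  ∀ v : ℝ → ENNReal, Literature.MathematicalPhysics.QuantumManyBody.BoseGas.IsRepulsiveFiniteRange v → ∃ η : ℝ, 0 < η ∧ ∃ ρ₀ : ℝ, 0 < ρ₀ ∧ ∀ ρ : ℝ, 0 < ρ → ρ < ρ₀ → ∀ᶠ N : ℕ in Filter.atTop, ∀ ε : ℝ, 0 < ε → ∃ δ : ENNReal, 0 < δ ∧ ∀ Ψ : Literature.MathematicalPhysics.QuantumManyBody.BoseGas.PeriodicTrialState N (Literature.MathematicalPhysics.QuantumManyBody.BoseGas.sideLength ρ N), Literature.MathematicalPhysics.QuantumManyBody.BoseGas.periodicEnergy v Ψ ≤ Literature.MathematicalPhysics.QuantumManyBody.BoseGas.periodicGroundStateEnergy v N (Literature.MathematicalPhysics.QuantumManyBody.BoseGas.sideLength ρ N) + δ → ∀ i : Fin N, let L : ℝ := Literature.MathematicalPhysics.QuantumManyBody.BoseGas.sideLength ρ N; let m : ℕ := ⌊L / η⌋₊;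 let G : EuclideanSpace ℝ (Fin 3) → ℝ := fun r => (∫ X in Literature.MathematicalPhysics.QuantumManyBody.BoseGas.cellN N L, conj (Ψ.ψ (Function.update X i (X i + r))) * Ψ.ψ X).re; (∀ r, 0 < G r) ∧ ∀ q : Fin 3 → Fin m, (∃ k, (q k : ℕ) ≠ 0) → -ε ≤ (∑ j : Fin 3 → Fin m, Real.log (G (Literature.MathematicalPhysics.QuantumManyBody.BoseGas.latticeVec (L / m) (fun k => ((j k : ℕ) : ℤ)))) * Real.cos (2 * Real.pi * (∑ k, ((q k : ℕ) : ℝ) * ((j k : ℕ) : ℝ)) / m)) / (m : ℝ) ^ 3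

/-- item stmt-AtomisticToContinuum-9115 · crux · rank 3 · open · by planner
why it might fail: A log-level infrared bound (Lévy weights summable against 1/|k| uniformly in N and in ρ→0): any expansion proof meets BogoliubovPerturbationInfrared at d=3, and beyond one-jump dominance ν_k≈n_k/n₀ nothing non-perturbative controls ν; ρ-uniformity of C is an extra bet.
sources: GavoretNozieres1964, Griffin1993, MoraCastin2003, LiebSeiringerSolovejYngvason2005, Fournais2020
[crux] (card M4, the quantity LOGCLUSTER was designed to bound) for every repulsive finite-range v
and every grid scale η > 0 there are C and ρ₀ > 0 such that for 0 < ρ < ρ₀, for all large N, some δ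
> 0: every δ-near-minimiser satisfies Σ_(q≢0) max(ν̃_q,0)/|k_q| ≤ C with |k_q| = (2π/L)·(centred
norm of q) — the positive part of the grid Lévy measure has an N-uniform (−1)-moment (Bogoliubov
value ≈ √2·a/π, density-independent; C may depend on v and η but not on ρ, N). [difficulty:
open-problem] -/
@[route_item "route-AtomisticToContinuum-BECInfDivCoherence", crux]
def LevyNegativeMoment : Prop :=
  ∀ v : ℝ → ENNReal, Literature.MathematicalPhysics.QuantumManyBody.BoseGas.IsRepulsiveFiniteRange v → ∀ η : ℝ, 0 < η → ∃ C : ℝ, ∃ ρ₀ : ℝ, 0 < ρ₀ ∧ ∀ ρ : ℝ, 0 < ρ → ρ < ρ₀ → ∀ᶠ N : ℕ in Filter.atTop, ∃ δ : ENNReal, 0 < δ ∧ ∀ Ψ : Literature.MathematicalPhysics.QuantumManyBody.BoseGas.PeriodicTrialState N (Literature.MathematicalPhysics.QuantumManyBody.BoseGas.sideLength ρ N), Literature.MathematicalPhysics.QuantumManyBody.BoseGas.periodicEnergy v Ψ ≤ Literature.MathematicalPhysics.QuantumManyBody.BoseGas.periodicGroundStateEnergy v N (Literature.MathematicalPhysics.QuantumManyBody.BoseGas.sideLength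 ρ N) + δ → ∀ i : Fin N, let L : ℝ := Literature.MathematicalPhysics.QuantumManyBody.BoseGas.sideLength ρ N; let m : ℕ := ⌊L / η⌋₊; let G : EuclideanSpace ℝ (Fin 3) → ℝ := fun r => (∫ X in Literature.MathematicalPhysics.QuantumManyBody.BoseGas.cellN N L, conj (Ψ.ψ (Function.update X i (X i + r))) * Ψ.ψ X).re; let ν : (Fin 3 → Fin m) → ℝ := fun q => (∑ j : Fin 3 → Fin m, Real.log (G (Literature.MathematicalPhysics.QuantumManyBody.BoseGas.latticeVec (L / m) (fun k => ((j k : ℕ) : ℤ)))) * Real.cos (2 * Real.pi * (∑ k, ((q k : ℕ) : ℝ) * ((j k : ℕ) : ℝ)) / m)) / (m : ℝ) ^ 3; (∑ q : Fin 3 → Fin m with (∃ k, (q k : ℕ) ≠ 0), max (ν q) 0 / (2 * Real.pi / L * Real.sqrt (∑ k, ((min (q k : ℕ) (m - (q k : ℕ)) : ℕ) : ℝ) ^ 2))) ≤ C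

/-- item stmt-AtomisticToContinuum-0827 · crux · rank 4 · open · by planner
why it might fail: PeriodicBEC(v) is ground-state-only (δ after N): the Dirichlet ground state lies a wall term ≫ δ above E₀^per and interior restrictions are neither periodic nor of sharp N, so the hypothesis may never fire; BEC is boundary-condition sensitive (Robinson1976).
sources: LiebSeiringerSolovejYngvason2005, BoccatoSeiringer2023, Junge2026, Robinson1976, LauwersVerbeureZagrebnov2003
[crux] BoundaryTransferWeak (mode-free boundary-condition transfer, per potential): for each
repulsive finite-range v, PeriodicBEC(v) implies ∃ρ₀>0 ∀ρ∈(0,ρ₀) HasGroundStateBEC v ρ (Dirichlet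
ground state, λ_max(γ) ≥ cN via condensateNumber). Not glue: near-minimiser slacks are O(N/L²) while
Dirichlet/periodic energies differ by a boundary term ≫ N/L², so no energy-comparison proof;
expected route: Neumann bracketing of interior sub-boxes (−Δ_Dir ≥ ⊕−Δ_Neu, v ≥ 0) + a mode-free
criterion (λ_max ≥ tr γ²/N). Only the ENERGY analogue is in print (LiebSeiringerSolovejYngvason2005
Ch. 2 after (2.8)). v ≡ 0: hypothesis and conclusion both true. -/
@[route_item "route-AtomisticToContinuum-BECInfDivCoherence", crux]
def BoundaryTransferWeak : Prop :=
  ∀ v : ℝ → ENNReal, Literature.MathematicalPhysics.QuantumManyBody.BoseGas.IsRepulsiveFiniteRange v → (∃ ρ₀ : ℝ, 0 < ρ₀ ∧ ∀ ρ : ℝ, 0 < ρ → ρ < ρ₀ → ∃ c : ℝ, 0 < c ∧ ∀ᶠ N : ℕ in Filter.atTop, ∃ δ : ENNReal, 0 < δ ∧ ∀ Ψ : Literature.MathematicalPhysics.QuantumManyBody.BoseGas.PeriodicTrialState N (Literature.MathematicalPhysics.QuantumManyBody.BoseGas.sideLength ρ N), Literature.MathematicalPhysics.QuantumManyBody.BoseGas.periodicEnergy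 v Ψ ≤ Literature.MathematicalPhysics.QuantumManyBody.BoseGas.periodicGroundStateEnergy v N (Literature.MathematicalPhysics.QuantumManyBody.BoseGas.sideLength ρ N) + δ → ENNReal.ofReal (c * N) ≤ Literature.MathematicalPhysics.QuantumManyBody.BoseGas.condensateOccupation N (Literature.MathematicalPhysics.QuantumManyBody.BoseGas.sideLength ρ N) Ψ.ψ) → ∃ ρ₀ : ℝ, 0 < ρ₀ ∧ ∀ ρ : ℝ, 0 < ρ → ρ < ρ₀ → Literature.MathematicalPhysics.QuantumManyBody.BoseGas.HasGroundStateBEC v ρ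

/-- item stmt-AtomisticToContinuum-9006 · support · rank 9 · closed · proved by Summit.AtomisticToContinuum.BoseEinsteinCondensation.Theorems.scatteringLengthFinite_proof @ 2b49af526fb0 (prover) · by planner
sources: LiebSeiringerSolovejYngvason2005
[support] (shared verbatim with route EqualScatteringTransfer, stmt-AtomisticToContinuum-0851)
finite range ⇒ scatteringLength v ≠ ⊤ (a ≤ R₀ + ε by the C¹ trial φ = 0 on B_{R₀}, = 1 off B_{R₀+ε};
hard cores included since ⊤·0 = 0). Discharges the `≠ ⊤` hypothesis of the cruxes in the glue.
[difficulty: provable-now] -/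
@[route_item "route-AtomisticToContinuum-BECInfDivCoherence", crux]
def ScatteringLengthFinite : Prop :=
  ∀ v : ℝ → ENNReal, Literature.MathematicalPhysics.QuantumManyBody.BoseGas.IsRepulsiveFiniteRange v → Literature.MathematicalPhysics.QuantumManyBody.BoseGas.scatteringLength v ≠ ⊤

/-- `ScatteringLengthFinite` holds: proved by `Summit.AtomisticToContinuum.BoseEinsteinCondensation.Theorems.scatteringLengthFinite_proof` @ 2b49af526fb0. -/
theorem ScatteringLengthFinite_holds : ScatteringLengthFinite := _root_.Summit.AtomisticToContinuum.BoseEinsteinCondensation.Theorems.scatteringLengthFinite_proof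

/-- item stmt-AtomisticToContinuum-9116 · support · rank 9 · closed · proved by Summit.AtomisticToContinuum.BoseEinsteinCondensation.Theorems.gridAverageCondensate_proof (prover) · by planner
sources: Fournais2020, LiebSeiringerSolovejYngvason2005
[support] (aliasing / Poincaré on cells, provable now) for L > 0, m ≥ 1, T ≥ 0, any periodic trial
state Ψ with total kinetic energy ≤ T and any particle i: condensateOccupation N L Ψ ≥ N·(grid
average of G_Ψ(i,·) over the m³ nodes (L/m)j) − T(L/m)²/(4π²). Proof: grid average = Σ_(k∈(2πm/L)ℤ³)
g_k with g_k = n_k/N ≥ 0 (Fourier in particle i), g_0 = n₀/N by the definition of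
condensateOccupation, and Σ_(|k|≥2πm/L) g_k ≤ (L/2πm)² Σ |k|² g_k = (L/2πm)²·(∫|∇_iΨ|²) = (L/2πm)²
T/N by Bose symmetry. [difficulty: provable-now] -/
@[route_item "route-AtomisticToContinuum-BECInfDivCoherence", crux]
def GridAverageCondensate : Prop :=
  ∀ (N m : ℕ) (L T : ℝ), 0 < L → 0 < m → 0 ≤ T → ∀ Ψ : Literature.MathematicalPhysics.QuantumManyBody.BoseGas.PeriodicTrialState N L, (∫⁻ X in Literature.MathematicalPhysics.QuantumManyBody.BoseGas.cellN N L, Literature.MathematicalPhysics.QuantumManyBody.BoseGas.kineticDensity Ψ.ψ X) ≤ ENNReal.ofReal T → ∀ i : Fin N, ENNReal.ofReal ((N : ℝ) * (∑ j : Fin 3 → Fin m, (∫ X in Literature.MathematicalPhysics.QuantumManyBody.BoseGas.cellN N L, conj (Ψ.ψ (Function.update X i (X i + Literature.MathematicalPhysics.QuantumManyBody.BoseGas.latticeVec (L / m) (fun k => ((j k : ℕ) : ℤ))))) * Ψ.ψ X).re) / (m : ℝ) ^ 3 - T * (L / m) ^ 2 / (4 * Real.pi ^ 2)) ≤ Literature.MathematicalPhysics.QuantumManyBody.BoseGas.condensateOccupation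 N L Ψ.ψ

/-- item stmt-AtomisticToContinuum-9117 · support · rank 9 · closed · proved by Summit.AtomisticToContinuum.BoseEinsteinCondensation.Theorems.levyMassCondensation_proof @ c37fc46976c3 (prover) · by planner
sources: BergChristensenRessel1984, LiebSeiringerSolovejYngvason2005, Fournais2020
[support] (glue, card M3–M4; conclusion = BECPeriodicReduction.PeriodicBEC = stmt-0826 body
verbatim, so closing it closes 0826 by a one-line theorem) GridInfDivCoherence → LevyNegativeMoment
→ ScatteringLengthFinite → GridAverageCondensate → constant-mode BEC for near-minimisers on the
torus at all small densities. Proof (finite-dimensional but for two inputs): fix v, take η, ρ₀ from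
GridInfDiv and C from LevyNegativeMoment at that η; for N large h := L/m ∈ [η, 2η), τ :=
(E₀^per+δ)/N ≤ τ* := 8πρa + 1 (LSSY2005_upperBound_periodic_holds + ScatteringLengthFinite); (i) G >
0 on the grid, F := log G∘nodes is real, even on (ℤ/m)³, so F(j) = Σ_q ν̃_q cos(2πq·j/m) and −F(j) =
Σ_(q≠0) ν̃_q(1 − cos) (F(0)=0); (ii) discrete f-sum: Σ_q ν̃_q λ_q = −(2/h²)Σ_a F(e_a) ≤ 2τ since 1 −
G(he_a) ≤ τ_a h²/2 (‖T_rΨ−Ψ‖ ≤ |r|‖∂_rΨ‖) and −log x ≤ 2(1−x) on [1/2,1], where λ_q =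
(2/h²)Σ_a(1−cos(2πq̄_a/m)) ≥ (4/π²)|k_q|²; with ν̃ ≥ −ε and ε := h²/(12m³): Σ ν̃⁺|k_q|² ≤
(π²/4)(2τ*+1); (iii) Hölder(3,3/2): Λ := Σ_(q≠0) ν̃_q ≤ Σ ν̃⁺ ≤ ((π²/4)(2τ*+1))^(1/3) C^(2/3) =: Λ*;
(iv) AM–GM over the m³ grid values: grid average of G ≥ exp(mean F) = e^(−Λ) ≥ e^(−Λ*); (v)
GridAverageCondensate: n₀/N ≥ e^(−Λ*) − τ*(2η)²/(4π -/
@[route_item "route-AtomisticToContinuum-BECInfDivCoherence", crux]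
def LevyMassCondensation : Prop :=
  GridInfDivCoherence → LevyNegativeMoment → ScatteringLengthFinite → GridAverageCondensate → ∀ v : ℝ → ENNReal, Literature.MathematicalPhysics.QuantumManyBody.BoseGas.IsRepulsiveFiniteRange v → ∃ ρ₀ : ℝ, 0 < ρ₀ ∧ ∀ ρ : ℝ, 0 < ρ → ρ < ρ₀ → ∃ c : ℝ, 0 < c ∧ ∀ᶠ N : ℕ in Filter.atTop, ∃ δ : ENNReal, 0 < δ ∧ ∀ Ψ : Literature.MathematicalPhysics.QuantumManyBody.BoseGas.PeriodicTrialState N (Literature.MathematicalPhysics.QuantumManyBody.BoseGas.sideLength ρ N), Literature.MathematicalPhysics.QuantumManyBody.BoseGas.periodicEnergy v Ψ ≤ Literature.MathematicalPhysics.QuantumManyBody.BoseGas.periodicGroundStateEnergy v N (Literature.MathematicalPhysics.QuantumManyBody.BoseGas.sideLength ρ N) + δ → ENNReal.ofReal (c * N) ≤ Literature.MathematicalPhysics.QuantumManyBody.BoseGas.condensateOccupation N (Literature.MathematicalPhysics.QuantumManyBody.BoseGas.sideLength ρ N) Ψ.ψ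

/-- item stmt-AtomisticToContinuum-9119 · assembly · rank 1 · closed · proved by Summit.AtomisticToContinuum.BoseEinsteinCondensation.Theorems.becInfDivCoherence_assembly_proof (prover) · by planner
sources: LiebSeiringerSolovejYngvason2005, PenroseOnsager1956
[assembly] GridInfDivCoherence → LevyNegativeMoment → ScatteringLengthFinite → GridAverageCondensate
→ LevyMassCondensation → BoundaryTransferWeak → BoseEinsteinCondensation (the audited sub-problem
Statement decl `_root_.BoseEinsteinCondensation`, by name; D-0027 §2.1). -/
@[route_item "route-AtomisticToContinuum-BECInfDivCoherence", crux]
def Assembly : Prop :=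
  GridInfDivCoherence → LevyNegativeMoment → ScatteringLengthFinite → GridAverageCondensate → LevyMassCondensation → BoundaryTransferWeak → _root_.BoseEinsteinCondensation

/-! D-0027 §2.1 — DECIDING THEOREM (planner-authored via `route open/edit --closes-file`; by planner-rrepair-AtomisticToContinuum-BECInfDiv-6e28679e-g2-0 2026-08-15T16:30:09Z):
its hypotheses are this route's items and its conclusion the sub-problem Statement (glue_lint), and it elaborates with this file. -/

@[closes "route-AtomisticToContinuum-BECInfDivCoherence"] theorem closes : GridInfDivCoherence → LevyNegativeMoment → BoundaryTransferWeak → ScatteringLengthFinite → GridAverageCondensate → LevyMassCondensation → Assembly → _root_.BoseEinsteinCondensation :=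
  fun h1 h2 h6 h3 h4 h5 _ v hv => h6 v hv (h5 h1 h2 h3 h4 v hv)

end Summit.AtomisticToContinuum.BoseEinsteinCondensation.Theses.BECInfDivCoherence
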